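import Summits.CriticalPhenomena.PercolationContinuityZ3.Theorems.Transplant.AutRelMilnorWords
import HarnessLib

/-!
# The relative Milnor lemma for actions by automorphisms, II: THE KERNEL OF A STABILISER-KILLING CHARACTER IS GENERATED BY ELEMENTS OF
# BOUNDED DISPLACEMENT (rank one)

builds on p205010 (kernel theorem, internal audit signed; external expert review pending) — nothing in this file uses p205010 and nothing here is about percolation.  Lane `prim-bschramm`, seat `prim-bschramm-p4` gen 25
(PART C3 of `P4-GENERAL.md` §47: INPUT(G) WITHOUT FINITE STABILISERS).  Helper file (`--supports stmt-CriticalPhenomena-4575 --as helper`).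

THE STATEMENT (`AutMilnor.inf_ker_eq_closure_bounded`).  `B` acts by automorphisms on a connected locally finite graph `G` whose balls about the
base vertex `t` grow subexponentially along every linear scale (`∀ R ≥ 1 ∃ m, |B(t, mR)| < 2^m` — automatic off exponential growth for transitive
actions, file III); `T ⊆ B` is FINITE, `B' = ⟨T ∪ Stab(t)⟩` (the stabiliser may be infinite, uncountable, anything); `ψ : B → ℤ` kills `Stab(t)`.
Then for some `m`, `B' ∩ ker ψ` is generated by its elements `g` with `g • t ∈ B(t, m)`.
THE PROOF (Milnor 1968, Lemma 1, run on the orbit).  Pick `x ∈ B'` with `ψ(x)` generating `ψ(B')` and kernel parts `a_s = s x^{-k_s}`; by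
Reidemeister–Schreier (file I) `B' ∩ ker ψ = ⟨x^k a_s x^{-k} : s ∈ T ∪ Stab(t), k ∈ ℤ⟩`.  The LEVELS `L_n = ⟨Stab(t), x^k a_s x^{-k} : |k| ≤ n⟩`
(§7) are raised by one under conjugation by `x^{±1}` BECAUSE THE STABILISER IS INSIDE THE GENERATING FAMILY (`x h x⁻¹ = x^1 a_h x^{-1}`,
`a_h = h`); file I gives for EVERY `s ∈ T ∪ Stab(t)` an index `n_s ≤ N` with `x^{±n_s} a_s x^{∓n_s} ∈ L_{n_s − 1}` where `N` depends only on the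
displacements — uniformly bounded since `T` is finite and stabiliser elements do not move `t`; propagation makes the levels stabilise at `N`,
so `B' ∩ ker ψ = L_N`, whose generators move `t` by at most `2N r_x + max_T r_{a_s}` (§8).
[cite: MilnorSolvableGrowth1968, Lemma 1 pp. 447–448] [cite: Rosset1976, Thm. 1] [cite: BenjaminiSchramm1996, §2 (almost transitive graphs)]
-/

noncomputable section

namespace Summit.CriticalPhenomena.PercolationContinuityZ3.Theorems.Transplant

open SimpleGraph Filter Literature.Barriers.CriticalPhenomena Literature.Probability.LatticeModels Literature.Probability.Percolation
open scoped Classical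

namespace AutMilnor

variable {V : Type} {G : SimpleGraph V} {B : Type} [Group B] [MulAction B V]

/-! ## §7 The level subgroups `L_n = ⟨Stab(t), x^k a_s x^{-k} : s ∈ S₀, |k| ≤ n⟩` -/

section Levels

variable (t : V) (S₀ : Set B) (x : B) (a : B → B)

/-- The level-`n` subgroup `L_n = ⟨Stab(t) ∪ {x^k a_s x^{-k} : s ∈ S₀, |k| ≤ n}⟩`. [cite: MilnorSolvableGrowth1968, p. 448] -/
def lev (n : ℕ) : Subgroup B :=
  Subgroup.closure (↑(MulAction.stabilizer B t) ∪ {g | ∃ s ∈ S₀, ∃ k : ℤ, k.natAbs ≤ n ∧ g = x ^ k * a s * (x ^ k)⁻¹})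

variable {t S₀ x a}

/-- The levels increase. [folklore] -/
theorem lev_mono {n n' : ℕ} (h : n ≤ n') : lev t S₀ x a n ≤ lev t S₀ x a n' := by
  refine Subgroup.closure_mono (Set.union_subset_union_right _ ?_)
  rintro g ⟨s, hs, k, hk, rfl⟩
  exact ⟨s, hs, k, hk.trans h, rfl⟩

/-- The stabiliser lies in every level. [folklore] -/
theorem stabilizer_le_lev (n : ℕ) : MulAction.stabilizer B t ≤ lev t S₀ x a n :=
  fun _ hh => Subgroup.subset_closure (Set.mem_union_left _ hh)

/-- A conjugate of small height lies in the level. [folklore] -/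
theorem conj_mem_lev {n : ℕ} {s : B} (hs : s ∈ S₀) {k : ℤ} (hk : k.natAbs ≤ n) : x ^ k * a s * (x ^ k)⁻¹ ∈ lev t S₀ x a n :=
  Subgroup.subset_closure (Set.mem_union_right _ ⟨s, hs, k, hk, rfl⟩)

/-- **Conjugation by `x` raises the level by one** (the stabiliser is INSIDE the generating family: `x h x⁻¹ = x^1 a_h x^{-1}` with `a_h = h`).
[cite: MilnorSolvableGrowth1968, p. 448 ("conjugating by β")] -/
theorem conj_x_mem_lev (hH : (↑(MulAction.stabilizer B t) : Set B) ⊆ S₀) (haH : ∀ h ∈ MulAction.stabilizer B t, a h = h) (n : ℕ)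
    {g : B} (hg : g ∈ lev t S₀ x a n) : x * g * x⁻¹ ∈ lev t S₀ x a (n + 1) := by
  refine Milnor.conj_mem_of_closure (fun y hy => ?_) hg
  rcases hy with hy | ⟨s, hs, k, hk, rfl⟩
  · have e : x * y * x⁻¹ = x ^ (1 : ℤ) * a y * (x ^ (1 : ℤ))⁻¹ := by rw [haH y hy, zpow_one]
    rw [e]
    exact conj_mem_lev (hH hy) (by simp)
  · have e : x * (x ^ k * a s * (x ^ k)⁻¹) * x⁻¹ = x ^ (k + 1) * a s * (x ^ (k + 1))⁻¹ := by rw [zpow_add, zpow_one]; group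
    rw [e]
    exact conj_mem_lev hs ((Int.natAbs_add_le k 1).trans (by simpa using hk))

/-- **Conjugation by `x⁻¹` raises the level by one.** [cite: MilnorSolvableGrowth1968, p. 448] -/
theorem conj_xinv_mem_lev (hH : (↑(MulAction.stabilizer B t) : Set B) ⊆ S₀) (haH : ∀ h ∈ MulAction.stabilizer B t, a h = h) (n : ℕ)
    {g : B} (hg : g ∈ lev t S₀ x a n) : x⁻¹ * g * x⁻¹⁻¹ ∈ lev t S₀ x a (n + 1) := by
  refine Milnor.conj_mem_of_closure (fun y hy => ?_) hg
  rcases hy with hy | ⟨s, hs, k, hk, rfl⟩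
  · have e : x⁻¹ * y * x⁻¹⁻¹ = x ^ (-1 : ℤ) * a y * (x ^ (-1 : ℤ))⁻¹ := by rw [haH y hy, zpow_neg, zpow_one]
    rw [e]
    exact conj_mem_lev (hH hy) (by simp)
  · have e : x⁻¹ * (x ^ k * a s * (x ^ k)⁻¹) * x⁻¹⁻¹ = x ^ (k + (-1)) * a s * (x ^ (k + (-1)))⁻¹ := by
      rw [zpow_add, zpow_neg, zpow_one]; group
    rw [e]
    exact conj_mem_lev hs ((Int.natAbs_add_le k (-1)).trans (by simpa using hk))

/-- Every element of the span of `conjSet'` lies in some level. [folklore] -/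
theorem exists_mem_lev {g : B} (hg : g ∈ Subgroup.closure (conjSet' S₀ x a)) : ∃ n, g ∈ lev t S₀ x a n := by
  induction hg using Subgroup.closure_induction with
  | mem y hy =>
    obtain ⟨s, hs, k, rfl⟩ := hy
    exact ⟨k.natAbs, conj_mem_lev hs le_rfl⟩
  | one => exact ⟨0, one_mem _⟩
  | mul y z _ _ hy hz =>
    obtain ⟨n₁, h₁⟩ := hy
    obtain ⟨n₂, h₂⟩ := hz
    exact ⟨max n₁ n₂, mul_mem (lev_mono (le_max_left _ _) h₁) (lev_mono (le_max_right _ _) h₂)⟩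
  | inv y _ hy =>
    obtain ⟨n, h⟩ := hy
    exact ⟨n, inv_mem h⟩

/-- Every level lies in the span of `Stab(t) ∪ conjSet'`. [folklore] -/
theorem lev_le (hK : MulAction.stabilizer B t ≤ Subgroup.closure (conjSet' S₀ x a)) (n : ℕ) :
    lev t S₀ x a n ≤ Subgroup.closure (conjSet' S₀ x a) := by
  refine (Subgroup.closure_le _).2 ?_
  rintro g (hg | ⟨s, hs, k, -, rfl⟩)
  · exact hK hg
  · exact Subgroup.subset_closure ⟨s, hs, k, rfl⟩

/-- **Propagation (positive side)**: `x^n a_s x^{-n} ∈ L_{n−1}` (`n ≥ 1`) ⟹ `x^{n+1} a_s x^{-(n+1)} ∈ L_n`. [cite: MilnorSolvableGrowth1968, p. 448] -/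
theorem prop_pos (hH : (↑(MulAction.stabilizer B t) : Set B) ⊆ S₀) (haH : ∀ h ∈ MulAction.stabilizer B t, a h = h) {s : B} {n : ℕ}
    (hn : 1 ≤ n) (h : x ^ (n : ℤ) * a s * (x ^ (n : ℤ))⁻¹ ∈ lev t S₀ x a (n - 1)) :
    x ^ ((n + 1 : ℕ) : ℤ) * a s * (x ^ ((n + 1 : ℕ) : ℤ))⁻¹ ∈ lev t S₀ x a (n + 1 - 1) := by
  have h' := conj_x_mem_lev hH haH (n - 1) h
  rw [Nat.sub_add_cancel hn] at h'
  have e : x ^ ((n + 1 : ℕ) : ℤ) * a s * (x ^ ((n + 1 : ℕ) : ℤ))⁻¹ = x * (x ^ (n : ℤ) * a s * (x ^ (n : ℤ))⁻¹) * x⁻¹ := by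
    push_cast
    rw [zpow_add, zpow_one]
    group
  rw [e, Nat.add_sub_cancel]
  exact h'

/-- **Propagation (negative side)**: `x^{-n} a_s x^{n} ∈ L_{n−1}` (`n ≥ 1`) ⟹ `x^{-(n+1)} a_s x^{n+1} ∈ L_n`. [cite: MilnorSolvableGrowth1968, p. 448] -/
theorem prop_neg (hH : (↑(MulAction.stabilizer B t) : Set B) ⊆ S₀) (haH : ∀ h ∈ MulAction.stabilizer B t, a h = h) {s : B} {n : ℕ}
    (hn : 1 ≤ n) (h : x ^ (-(n : ℤ)) * a s * (x ^ (-(n : ℤ)))⁻¹ ∈ lev t S₀ x a (n - 1)) :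
    x ^ (-((n + 1 : ℕ) : ℤ)) * a s * (x ^ (-((n + 1 : ℕ) : ℤ)))⁻¹ ∈ lev t S₀ x a (n + 1 - 1) := by
  have h' := conj_xinv_mem_lev hH haH (n - 1) h
  rw [Nat.sub_add_cancel hn] at h'
  have e : x ^ (-((n + 1 : ℕ) : ℤ)) * a s * (x ^ (-((n + 1 : ℕ) : ℤ)))⁻¹ =
      x⁻¹ * (x ^ (-(n : ℤ)) * a s * (x ^ (-(n : ℤ)))⁻¹) * x⁻¹⁻¹ := by
    push_cast
    rw [neg_add, zpow_add, zpow_neg, zpow_neg, zpow_one]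
    group
  rw [e, Nat.add_sub_cancel]
  exact h'

/-- **Eventual membership**: from one index `n₀ ∈ [1, N]` on, by propagation, for all `n ≥ N`. [cite: MilnorSolvableGrowth1968, p. 448] -/
theorem eventually_of_prop {P : ℕ → Prop} (hP : ∀ n, 1 ≤ n → P n → P (n + 1)) {n₀ N : ℕ} (h1 : 1 ≤ n₀) (hle : n₀ ≤ N)
    (h0 : P n₀) : ∀ n, N ≤ n → P n := by
  have key : ∀ d : ℕ, P (n₀ + d) := by
    intro d
    induction d with
    | zero => exact h0
    | succ d ih => exact hP (n₀ + d) (by omega) ih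
  intro n hn
  have e : n = n₀ + (n - n₀) := by omega
  rw [e]
  exact key _

/-- The relative span of the positive conjugates lies in the level. [folklore] -/
theorem relSpan_le_lev {s : B} (hs : s ∈ S₀) (j : ℕ) : relSpan t x (a s) j ≤ lev t S₀ x a j := by
  refine (Subgroup.closure_le _).2 ?_
  rintro g (hg | ⟨i, hi, rfl⟩)
  · exact stabilizer_le_lev j hg
  · rw [Milnor.conj_eq_zpow]
    exact conj_mem_lev hs (by rw [Int.natAbs_natCast]; exact hi.2)

/-- The relative span of the negative conjugates lies in the level. [folklore] -/
theorem relSpan_inv_le_lev {s : B} (hs : s ∈ S₀) (j : ℕ) : relSpan t x⁻¹ (a s) j ≤ lev t S₀ x a j := by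
  refine (Subgroup.closure_le _).2 ?_
  rintro g (hg | ⟨i, hi, rfl⟩)
  · exact stabilizer_le_lev j hg
  · rw [Milnor.conj_inv_eq_zpow]
    exact conj_mem_lev hs (by rw [Int.natAbs_neg, Int.natAbs_natCast]; exact hi.2)

/-- **Stabilisation of the levels**: if at every height `n + 1 > N` both extreme conjugates of every `s ∈ S₀` already lie in `L_n`, then
`L_n = L_N` for all `n ≥ N`. [cite: MilnorSolvableGrowth1968, p. 448 ("Continuing inductively")] -/
theorem lev_eq_of_stable {N : ℕ}
    (hpos : ∀ s ∈ S₀, ∀ n, N ≤ n → x ^ ((n + 1 : ℕ) : ℤ) * a s * (x ^ ((n + 1 : ℕ) : ℤ))⁻¹ ∈ lev t S₀ x a n)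
    (hneg : ∀ s ∈ S₀, ∀ n, N ≤ n → x ^ (-((n + 1 : ℕ) : ℤ)) * a s * (x ^ (-((n + 1 : ℕ) : ℤ)))⁻¹ ∈ lev t S₀ x a n) :
    ∀ n, N ≤ n → lev t S₀ x a n = lev t S₀ x a N := by
  have step : ∀ n, N ≤ n → lev t S₀ x a (n + 1) ≤ lev t S₀ x a n := by
    intro n hn
    refine (Subgroup.closure_le _).2 ?_
    rintro g (hg | ⟨s, hs, k, hk, rfl⟩)
    · exact stabilizer_le_lev n hg
    · rcases Nat.lt_or_ge k.natAbs (n + 1) with hlt | hge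
      · exact conj_mem_lev hs (by omega)
      · have heq : k.natAbs = n + 1 := le_antisymm hk hge
        rcases Int.natAbs_eq k with e | e
        · rw [e, heq]; exact hpos s hs n hn
        · rw [e, heq]; exact hneg s hs n hn
  intro n hn
  induction n with
  | zero =>
    have : N = 0 := by omega
    subst this; rfl
  | succ n ih =>
    rcases Nat.lt_or_ge n N with hlt | hge
    · have : N = n + 1 := by omega
      subst this; rfl
    · exact le_antisymm ((step n hge).trans (ih hge).le) ((ih hge).symm.le.trans (lev_mono (Nat.le_succ n)))

end Levels

/-! ## §8 THE RELATIVE KERNEL LEMMA (rank one): the kernel is generated by elements of BOUNDED DISPLACEMENT -/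

/-- Every vertex of a connected graph is at finite distance: `g • t ∈ B(t, r)` for some `r`. [folklore] -/
theorem exists_smul_mem_graphBall (hc : G.Connected) (t : V) (g : B) : ∃ r : ℕ, g • t ∈ graphBall G t r := by
  obtain ⟨w⟩ := hc.preconnected t (g • t)
  exact ⟨w.length, w, le_rfl⟩

/-- **THE RELATIVE MILNOR KERNEL LEMMA (rank one).**  `B` acts by automorphisms on a connected locally finite graph whose balls about `t` grow
subexponentially along every linear scale; `T ⊆ B` is finite and `B' = ⟨T ∪ Stab(t)⟩`; `ψ : B → ℤ` is a character killing `Stab(t)`.  Then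
`B' ∩ ker ψ` is generated by its elements moving `t` by at most `m`, for some `m` — Milnor's lemma with the (possibly infinite, possibly
uncountable) stabiliser inside the generating family: stabiliser elements do not move `t`, so Milnor's counting bound is UNIFORM over them.
[cite: MilnorSolvableGrowth1968, Lemma 1 pp. 447–448] [cite: Rosset1976, Thm. 1] [cite: BenjaminiSchramm1996, §2 (almost transitive graphs)] -/
theorem inf_ker_eq_closure_bounded [G.LocallyFinite] (hact : IsActionByAut G B) (hc : G.Connected) (t : V)
    (hsub : ∀ R : ℕ, 1 ≤ R → ∃ m : ℕ, ballVolume G t (m * R) < 2 ^ m) (T : Finset B) (ψ : B →* Multiplicative ℤ)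
    (hψ : ∀ h ∈ MulAction.stabilizer B t, ψ h = 1) :
    ∃ m : ℕ, Subgroup.closure (↑T ∪ (↑(MulAction.stabilizer B t) : Set B)) ⊓ ψ.ker =
      Subgroup.closure {g | g ∈ Subgroup.closure (↑T ∪ (↑(MulAction.stabilizer B t) : Set B)) ⊓ ψ.ker ∧ g • t ∈ graphBall G t m} := by
  set H := MulAction.stabilizer B t with hH_def
  set S₀ : Set B := ↑T ∪ (↑H : Set B) with hS₀_def
  set B' := Subgroup.closure S₀ with hB'_def
  -- the easy inclusion, used in both cases
  have hge : ∀ m : ℕ, Subgroup.closure {g | g ∈ B' ⊓ ψ.ker ∧ g • t ∈ graphBall G t m} ≤ B' ⊓ ψ.ker := fun m =>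
    (Subgroup.closure_le _).2 fun g hg => hg.1
  -- displacements of the finitely many `τ ∈ T`
  have hdisp : ∀ g : B, ∃ r : ℕ, g • t ∈ graphBall G t r := exists_smul_mem_graphBall hc t
  choose r hr using hdisp
  -- a generator `x` of `ψ(B')`
  obtain ⟨x, hxB', hgen⟩ := exists_generator' ψ B'
  set d : ℤ := Multiplicative.toAdd (ψ x) with hd_def
  by_cases hd : d = 0
  · -- `ψ` vanishes on `B'`: `B' ∩ ker ψ = B' = ⟨T ∪ H⟩`, generators of displacement `≤ max_T r`
    have hker : B' ≤ ψ.ker := fun g hg => by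
      obtain ⟨k, hk⟩ := hgen g hg
      rw [MonoidHom.mem_ker, ← ofAdd_toAdd (ψ g), hk, hd, mul_zero, ofAdd_zero]
    refine ⟨T.sup r, le_antisymm ?_ (hge _)⟩
    rw [inf_eq_left.2 hker]
    refine (Subgroup.closure_le _).2 fun g hg => ?_
    have hgB' : g ∈ B' := Subgroup.subset_closure hg
    have hdisp : g • t ∈ graphBall G t (T.sup r) := by
      rcases hg with hg | hg
      · exact graphBall_mono _ _ (Finset.le_sup (f := r) (Finset.mem_coe.1 hg)) (hr g)
      · exact smul_mem_graphBall_of_mem_stabilizer hg _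
    have hmem : g ∈ {g | g ∈ B' ∧ g • t ∈ graphBall G t (T.sup r)} := ⟨hgB', hdisp⟩
    exact Subgroup.subset_closure hmem
  · -- exponents and kernel parts
    choose! kf hkf using hgen
    set a : B → B := fun s => s * (x ^ kf s)⁻¹ with ha_def
    have hHS₀ : (↑H : Set B) ⊆ S₀ := Set.subset_union_right
    have hS₀B' : S₀ ⊆ B' := Subgroup.subset_closure
    have haK : ∀ s ∈ S₀, a s ∈ ψ.ker := by
      intro s hs
      have hk := hkf s (hS₀B' hs)
      rw [MonoidHom.mem_ker, ← ofAdd_toAdd (ψ (a s)), ha_def]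
      simp only [map_mul, map_inv, map_zpow, toAdd_mul, toAdd_inv, toAdd_zpow, hk, ← hd_def, smul_eq_mul]
      rw [add_neg_cancel, ofAdd_zero]
    have hs : ∀ s ∈ S₀, ∃ k : ℤ, s = a s * x ^ k := fun s _ => ⟨kf s, by rw [ha_def]; group⟩
    have hinj : ∀ k : ℤ, x ^ k ∈ ψ.ker → k = 0 := by
      intro k hk
      rw [MonoidHom.mem_ker, map_zpow] at hk
      have h' : k * d = 0 := by
        have := congrArg Multiplicative.toAdd hk
        rwa [toAdd_zpow, toAdd_one, smul_eq_mul] at this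
      rcases mul_eq_zero.1 h' with h | h
      · exact h
      · exact absurd h hd
    have haH : ∀ h ∈ H, a h = h := by
      intro h hh
      have hk := hkf h (hS₀B' (hHS₀ hh))
      rw [hψ h hh, toAdd_one] at hk
      have hk0 : kf h = 0 := by
        rcases mul_eq_zero.1 hk.symm with h0 | h0
        · exact h0
        · exact absurd h0 hd
      show h * (x ^ kf h)⁻¹ = h
      rw [hk0, zpow_zero, inv_one, mul_one]
    have heq : B' ⊓ ψ.ker = Subgroup.closure (conjSet' S₀ x a) := closure_inf_ker_eq' ψ S₀ x a hxB' haK hs hinj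
    have hHK : H ≤ Subgroup.closure (conjSet' S₀ x a) := by
      rw [← heq]
      exact fun h hh => ⟨hS₀B' (hHS₀ hh), hψ h hh⟩
    -- displacements: `x`, `x⁻¹`, and a uniform bound `Ra` for `a s`, `s ∈ S₀`
    set rx : ℕ := r x with hrx_def
    have hx : x • t ∈ graphBall G t rx := hr x
    have hxi : x⁻¹ • t ∈ graphBall G t rx := inv_smul_mem_graphBall hact (hr x)
    have hxii : x⁻¹⁻¹ • t ∈ graphBall G t rx := by rw [inv_inv]; exact hx
    set Ra : ℕ := T.sup (fun s => r (a s)) with hRa_def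
    have haR : ∀ s ∈ S₀, a s • t ∈ graphBall G t Ra := by
      intro s hs'
      rcases hs' with hs' | hs'
      · exact graphBall_mono _ _ (Finset.le_sup (f := fun s => r (a s)) (Finset.mem_coe.1 hs')) (hr (a s))
      · rw [haH s hs']
        exact smul_mem_graphBall_of_mem_stabilizer hs' _
    -- Milnor's counting bound, uniform over `S₀`
    obtain ⟨N, hN⟩ := hsub (Ra + rx + 1) (by omega)
    have hposN : ∀ s ∈ S₀, ∀ n, N ≤ n → x ^ ((n + 1 : ℕ) : ℤ) * a s * (x ^ ((n + 1 : ℕ) : ℤ))⁻¹ ∈ lev t S₀ x a n := by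
      intro s hs' n hn
      obtain ⟨n₀, h1, hle, hmem⟩ := exists_conj_mem_relSpan_le hact x (a s) hxi (haR s hs') hN
      have h0 : x ^ (n₀ : ℤ) * a s * (x ^ (n₀ : ℤ))⁻¹ ∈ lev t S₀ x a (n₀ - 1) := by
        rw [← Milnor.conj_eq_zpow]
        exact relSpan_le_lev hs' _ hmem
      have hall := eventually_of_prop (P := fun n => x ^ (n : ℤ) * a s * (x ^ (n : ℤ))⁻¹ ∈ lev t S₀ x a (n - 1))
        (fun n hn1 hPn => prop_pos hHS₀ haH hn1 hPn) h1 hle h0 (n + 1) (by omega)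
      rwa [Nat.add_sub_cancel] at hall
    have hnegN : ∀ s ∈ S₀, ∀ n, N ≤ n → x ^ (-((n + 1 : ℕ) : ℤ)) * a s * (x ^ (-((n + 1 : ℕ) : ℤ)))⁻¹ ∈ lev t S₀ x a n := by
      intro s hs' n hn
      obtain ⟨n₀, h1, hle, hmem⟩ := exists_conj_mem_relSpan_le hact x⁻¹ (a s) hxii (haR s hs') hN
      have h0 : x ^ (-(n₀ : ℤ)) * a s * (x ^ (-(n₀ : ℤ)))⁻¹ ∈ lev t S₀ x a (n₀ - 1) := by
        rw [← Milnor.conj_inv_eq_zpow]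
        exact relSpan_inv_le_lev hs' _ hmem
      have hall := eventually_of_prop (P := fun n => x ^ (-(n : ℤ)) * a s * (x ^ (-(n : ℤ)))⁻¹ ∈ lev t S₀ x a (n - 1))
        (fun n hn1 hPn => prop_neg hHS₀ haH hn1 hPn) h1 hle h0 (n + 1) (by omega)
      rwa [Nat.add_sub_cancel] at hall
    have hstab := lev_eq_of_stable hposN hnegN
    -- `B' ∩ ker ψ = L_N`
    have hkerN : B' ⊓ ψ.ker = lev t S₀ x a N := by
      refine le_antisymm ?_ ?_
      · intro g hg
        rw [heq] at hg
        obtain ⟨n, hn⟩ := exists_mem_lev (t := t) hg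
        have hmono := lev_mono (t := t) (S₀ := S₀) (x := x) (a := a) (le_max_left n N) hn
        rwa [hstab (max n N) (le_max_right _ _)] at hmono
      · rw [heq]
        exact lev_le hHK N
    -- displacement bound for the generators of `L_N`
    refine ⟨2 * (N * rx) + Ra, le_antisymm ?_ (hge _)⟩
    rw [hkerN]
    refine (Subgroup.closure_le _).2 ?_
    rintro g (hg | ⟨s, hs', k, hk, rfl⟩)
    · have hmem : g ∈ {g | g ∈ lev t S₀ x a N ∧ g • t ∈ graphBall G t (2 * (N * rx) + Ra)} :=
        ⟨stabilizer_le_lev N hg, smul_mem_graphBall_of_mem_stabilizer hg _⟩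
      exact Subgroup.subset_closure hmem
    · have hmem : x ^ k * a s * (x ^ k)⁻¹ ∈ {g | g ∈ lev t S₀ x a N ∧ g • t ∈ graphBall G t (2 * (N * rx) + Ra)} := by
        refine ⟨conj_mem_lev hs' hk, ?_⟩
        refine graphBall_mono _ _ ?_ (zpow_conj_smul_mem_graphBall hact hx (haR s hs') k)
        have := Nat.mul_le_mul_right rx hk
        omega
      exact Subgroup.subset_closure hmem

end AutMilnor

end Summit.CriticalPhenomena.PercolationContinuityZ3.Theorems.Transplant

end
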